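/- Free lead seat `ym-line-cbag-p1` (prover-ym-line-cbag-p1-g20-0; own crux `BoxFloorAllGroups` stmt-QuantumFields-22254 CLOSED) on the
planner-of-record's LINE 5, route `HankelDensitySplitting`: the CLOSING file of crux `HankelDensityFloor` (stmt-QuantumFields-26618) — the
registered birth skeleton (planner ym-idea-2 g3, sha f0c071d1…) with its four stubs landed by name (stub 1 by width seat w3 g8, stubs 2–4 by this
seat).  RECORD-type material: the node `LatticeNonFreezing` stays conditional on the route's other crux `LogWindowMixedDominance`; the
Yang–Mills mass gap is NOT proved by anything here. -/
import Summits.QuantumFields.YangMills.Theorems.HankelDensitySplittingHankelDensityFloorFixedDistanceLower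
import Summits.QuantumFields.YangMills.Theorems.HankelDensitySplittingHankelDensityFloorNearUpper
import Summits.QuantumFields.YangMills.Theorems.HankelDensitySplittingHankelDensityFloorLogConvex
import Summits.QuantumFields.YangMills.Theorems.HankelDensitySplittingHankelDensityFloorFloorOfDoors

/-!
# Route `HankelDensitySplitting`: the crux `HankelDensityFloor` (stmt-QuantumFields-26618), proved

`HankelDensityFloor`: for every compact simple `G`, faithful unitary lattice representation `r` and rate `ε > 0` there are `c > 0`, `β₁` with
`c β⁻² e^{−ε n} ≤ F_μ(n)` for all `β ≥ β₁`, all infinite-volume torus-limit states `μ` at `β` and all `n ≥ 1`, where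
`F_μ(n) = t_μ(n) + g_μ(n−1)` is the REFLECTION-PAIRED density–density correlator (Hankel form `⟨θ trF² · τ_{n−1} trF²⟩`) — the quantitative
`ξ → ∞` floor for the Hankel half, uniform over limit states.

Composition of the registered skeleton (`hankelDensityFloor_of_doors`, file `…HankelDensityFloorDefs`):
* stub 1 `stub_hankelFixedDistanceLower` (`…FixedDistanceLower`, seat w3 g8): the fixed-distance floor `A/(β² n⁸) ≤ F_μ(n)` from the landed
  axial floor `fixedDistanceLower_proof` and the cross-plane second-order local law (`CrossPlane.secondOrder_pair_of_expMoment`);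
* stub 2 `stub_hankelNearUpper` (`…NearUpper`): `F_μ(1) ≤ B/β²` from `plaquetteVarianceUpper_proof`, every site and plane;
* stub 3 `stub_hankelLogConvex` (`…LogConvexTorus`, `…LogConvexCones`, `…LogConvex`): Osterwalder–Seiler reflection positivity of the torus
  Wilson states in link and site hyperplanes (odd tori at both fixed hyperplanes of the mixed reflection) for the composite six-plane axial
  observables, passage to the limit point — `F_μ` is non-negative, non-increasing and log-convex from `n = 1`;
* stub 4 `stub_floorOfDoors` (`…FloorOfDoors`): the chord argument on the log-convex sequence (the two `β⁻²` cancel in the slope).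

The simplicity of `G` enters only through the landed `DirichletWindow` inputs.  Sources: K. Osterwalder, E. Seiler, Ann. Phys. 110 (1978) §2;
E. Seiler, LNP 159 (1982) Ch. 2; S. Chatterjee, arXiv:1602.01222 §§11–14, arXiv:1803.01950 Problem 5.1.  NOT the Yang–Mills mass gap; the
node `LatticeNonFreezing` is NOT proved here (it needs the route's crux `LogWindowMixedDominance`).
-/

noncomputable section

namespace Summit.QuantumFields.YangMills.Theorems.HankelDensitySplitting

/-- **Crux `HankelDensityFloor` of route `HankelDensitySplitting` (stmt-QuantumFields-26618), proved** by the registered skeleton's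
composition `hankelDensityFloor_of_doors` of its four landed stubs `stub_hankelFixedDistanceLower`, `stub_hankelNearUpper`,
`stub_hankelLogConvex`, `stub_floorOfDoors`.  NOT the Yang–Mills mass gap; NOT the node `LatticeNonFreezing`. -/
theorem hankelDensityFloor_proof : Summit.QuantumFields.YangMills.Theses.HankelDensitySplitting.HankelDensityFloor :=
  hankelDensityFloor_of_doors stub_hankelFixedDistanceLower stub_hankelNearUpper stub_hankelLogConvex stub_floorOfDoors

end Summit.QuantumFields.YangMills.Theorems.HankelDensitySplitting

end
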